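import Summits.RiemannHypothesis.RiemannHypothesis.Theorems.WeilFormatCDeflatedFarImages
import Summits.RiemannHypothesis.RiemannHypothesis.Theorems.WeilFormatCSectorBasis
import Summits.RiemannHypothesis.RiemannHypothesis.Theorems.WeilFormatCEntrySesq
import Summits.RiemannHypothesis.RiemannHypothesis.Theorems.WeilFormatCEntryGram
import HarnessLib

/-!
# Format C, design C∞: sector bookkeeping for EVEN profiles — kernel rows in the even sector

Route context: Fourier–Galerkin / Schur-complement certificates of Weil positivity on a window ("format C";
cell memo `run/shared/lean/pub/rh-explicit/rh-explicit-weil-10/KERNEL-LEVER.md` §18–§19; supporting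
stmt-RiemannHypothesis-0098; seat rh-explicit-weil-10).

The C∞ soundness theorem (`sum_range_mul_mul_nonneg_of_certificate_cinf`) is stated for an `ℕ`-indexed sector kernel
`M`, a real profile table `V` and the limit images `c∞(m,j) = lim_P Σ_{n∈[B,P)} M(n,m)V(n,j)`.  This file supplies that
bookkeeping for the EVEN sector of Yoshida's matrix `G = gramCoeff a`:
`M⁺(n,m) = [n = 0] G(0,m) ; [m = 0] G(n,0) ; (G(n,m) + G(n,−m))/2`, profiles = even windows.

* `fourierCoeff_comp_neg`, `conj_fourierCoeff`, `fourierCoeff_neg_eq_of_even`, `im_fourierCoeff_eq_zero_of_even_real` —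
  the window Fourier coefficients of an even real window are even and real;
* `weilWindowSesq_chiEven_chiEven` — the Gram matrix of weil-2's even basis `w⁺` IS the even kernel up to the diagonal
  scaling `d_0 = 1`, `d_n = √2`: `W_a(w⁺_n, w⁺_m) = d_n d_m M⁺(n,m)`;
* `proj_eq_sum_chiEven`, `band_eq_sum_chiEven` — for an even window, `proj_P φ` and the band `proj_P φ − proj_{B'} φ`
  expand on `w⁺_i`, `i ∈ [0, P]` resp. `i ∈ [B'+1, P]`, with coefficients `ζ_i = d_i ĉ_i(φ)/√(2a)`;
* `sum_Ico_evenKernel_mul_eq` — THE ROW IDENTITY: with the real table `V(n) = d_n² Re ĉ_n(φ)/√(2a)`,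
  `Σ_{n∈[B'+1,P+1)} M⁺(n,m)V(n) = Re W_a(proj_P φ − proj_{B'} φ, w⁺_m)/d_m`;
* `sum_Ico_Ico_evenKernel_eq` — the band × band entry: `Σ_{n,n'} V(n)M⁺(n,n')V'(n') = Re W_a(band φ, band φ')`;
* `tendsto_sum_Ico_evenKernel_mul`, `tendsto_sum_Ico_Ico_evenKernel` — for admissible even real profiles `1f`
  (`f ∈ C³`, even, real, `f′(a) = 0`) the hypotheses `hc`, `hG` of the soundness theorem, with the limits
  `Re W_a(1f − proj_{B'}(1f), w⁺_m)/d_m` and `Re W_a(1f − proj_{B'}1f, 1g − proj_{B'}1g)`.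

Pure bookkeeping on landed identities; standard axioms; no definitions; no RH claim.
-/

set_option autoImplicit false
-- `Summit.RiemannHypothesis.RiemannHypothesis.…` is the layout-mandated namespace (summit = problem name).
set_option linter.dupNamespace false

noncomputable section

open Complex Filter Set MeasureTheory Finset
open scoped Real Topology ComplexConjugate

namespace Summit.RiemannHypothesis.RiemannHypothesis.Theorems.WeilFormatC

open Literature.NumberTheory.LFunctions Literature.NumberTheory.LFunctions.Yoshida1992

variable {a : ℝ}

/-! ## Fourier coefficients of even real windows -/

/-- Reflection: `ĉ_n(φ(−·)) = ĉ_{−n}(φ)`. -/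
theorem fourierCoeff_comp_neg (a : ℝ) (n : ℤ) (φ : ℝ → ℂ) :
    Yoshida1992.fourierCoeff a n (fun x ↦ φ (-x)) = Yoshida1992.fourierCoeff a (-n) φ := by
  unfold Yoshida1992.fourierCoeff
  have h := intervalIntegral.integral_comp_neg (a := -a) (b := a)
    (f := fun x ↦ φ x * cexp (-(π * I * ((-n : ℤ) : ℂ) * x / a)))
  simp only [neg_neg] at h
  rw [← h]
  refine intervalIntegral.integral_congr fun x _ ↦ ?_
  simp only
  congr 2
  push_cast
  ring

/-- Conjugation: `conj ĉ_n(φ) = ĉ_{−n}(conj ∘ φ)`. -/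
theorem conj_fourierCoeff (a : ℝ) (n : ℤ) (φ : ℝ → ℂ) :
    conj (Yoshida1992.fourierCoeff a n φ) = Yoshida1992.fourierCoeff a (-n) (fun x ↦ conj (φ x)) := by
  have hpt : ∀ x : ℝ, conj (φ x * cexp (-(π * I * n * x / a)))
      = conj (φ x) * cexp (-(π * I * ((-n : ℤ) : ℂ) * x / a)) := by
    intro x
    rw [map_mul, ← Complex.exp_conj]
    congr 2
    simp only [map_neg, map_mul, map_div₀, Complex.conj_ofReal, Complex.conj_I, map_intCast]
    push_cast
    ring
  unfold Yoshida1992.fourierCoeff intervalIntegral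
  rw [map_sub, ← integral_conj, ← integral_conj]
  simp_rw [hpt]

/-- Even windows have even coefficients: `ĉ_{−n}(φ) = ĉ_n(φ)`. -/
theorem fourierCoeff_neg_eq_of_even {φ : ℝ → ℂ} (hφ : ∀ x, φ (-x) = φ x) (a : ℝ) (n : ℤ) :
    Yoshida1992.fourierCoeff a (-n) φ = Yoshida1992.fourierCoeff a n φ := by
  rw [← fourierCoeff_comp_neg]
  simp_rw [hφ]

/-- Even REAL windows have real coefficients: `Im ĉ_n(φ) = 0`. -/
theorem im_fourierCoeff_eq_zero_of_even_real {φ : ℝ → ℂ} (hφ : ∀ x, φ (-x) = φ x) (hφr : ∀ x, conj (φ x) = φ x)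
    (a : ℝ) (n : ℤ) :
    (Yoshida1992.fourierCoeff a n φ).im = 0 := by
  have h := conj_fourierCoeff a n φ
  simp_rw [hφr] at h
  rw [fourierCoeff_neg_eq_of_even hφ] at h
  exact Complex.conj_eq_iff_im.1 h

/-- A real-valued coefficient as the cast of its real part. -/
theorem fourierCoeff_eq_ofReal_re {φ : ℝ → ℂ} (hφ : ∀ x, φ (-x) = φ x) (hφr : ∀ x, conj (φ x) = φ x)
    (a : ℝ) (n : ℤ) :
    Yoshida1992.fourierCoeff a n φ = (((Yoshida1992.fourierCoeff a n φ).re : ℝ) : ℂ) := by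
  apply Complex.ext
  · simp
  · rw [Complex.ofReal_im, im_fourierCoeff_eq_zero_of_even_real hφ hφr]

/-- The indicator of an even function on `[−a, a]` is even. -/
theorem indicator_even {f : ℝ → ℂ} (hf : ∀ x, f (-x) = f x) (a x : ℝ) :
    (Icc (-a) a).indicator f (-x) = (Icc (-a) a).indicator f x := by
  by_cases hx : x ∈ Icc (-a) a
  · have hx' : -x ∈ Icc (-a) a := ⟨by linarith [hx.2], by linarith [hx.1]⟩
    rw [indicator_of_mem hx, indicator_of_mem hx', hf]
  · have hx' : -x ∉ Icc (-a) a := fun h ↦ hx ⟨by linarith [h.2], by linarith [h.1]⟩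
    rw [indicator_of_notMem hx, indicator_of_notMem hx']

/-- The indicator of a real-valued function is real-valued. -/
theorem indicator_real {f : ℝ → ℂ} (hf : ∀ x, conj (f x) = f x) (a x : ℝ) :
    conj ((Icc (-a) a).indicator f x) = (Icc (-a) a).indicator f x := by
  by_cases hx : x ∈ Icc (-a) a
  · rw [indicator_of_mem hx, hf]
  · rw [indicator_of_notMem hx, map_zero]

/-! ## The even basis Gram is the even kernel -/

/-- **`W_a(w⁺_n, w⁺_m) = d_n d_m M⁺(n,m)`** with `d_0 = 1`, `d_n = √2` (`n ≥ 1`), `M⁺` the even sector kernel of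
`G = gramCoeff a` (`a > 0`). -/
theorem weilWindowSesq_chiEven_chiEven (ha : 0 < a) (n m : ℕ) :
    weilWindowSesq a (chiEven a n) (chiEven a m) =
      (((if n = 0 then 1 else Real.sqrt 2) * (if m = 0 then 1 else Real.sqrt 2) *
        (if n = 0 then gramCoeff a 0 m else if m = 0 then gramCoeff a n 0
          else (gramCoeff a n m + gramCoeff a n (-(m : ℤ))) / 2) : ℝ) : ℂ) := by
  have hs2 : Real.sqrt 2 * Real.sqrt 2 = 2 := Real.mul_self_sqrt (by norm_num)
  have hsC : ((1 / Real.sqrt 2 : ℝ) : ℂ) = ((Real.sqrt 2 : ℝ) : ℂ) / 2 := by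
    rw [← Complex.ofReal_ofNat, ← Complex.ofReal_div]
    congr 1
    rw [div_eq_div_iff (Real.sqrt_pos.2 (by norm_num : (0:ℝ) < 2)).ne' two_ne_zero, one_mul, hs2]
  have hrefl0 : ∀ k : ℤ, gramCoeff a 0 (-k) = gramCoeff a 0 k := fun k ↦ by
    have := gramCoeff_neg_neg a 0 k; rwa [neg_zero] at this
  have hrefl0' : ∀ k : ℤ, gramCoeff a (-k) 0 = gramCoeff a k 0 := fun k ↦ by
    have := gramCoeff_neg_neg a k 0; rwa [neg_zero] at this
  by_cases hn : n = 0
  · subst hn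
    by_cases hm : m = 0
    · subst hm
      simp only [chiEven, if_true, Nat.cast_zero, one_mul]
      rw [weilWindowSesq_chi ha]
    · simp only [chiEven, if_true, if_neg hm, one_mul]
      rw [weilWindowSesq_smul_right, Complex.conj_ofReal,
        weilWindowSesq_add_right ha.le (isWindowFunction_chi ha _) (isWindowFunction_chi ha _)
          (isWindowFunction_chi ha _), weilWindowSesq_chi ha, weilWindowSesq_chi ha, hrefl0, hsC]
      push_cast
      ring
  · by_cases hm : m = 0
    · subst hm
      simp only [chiEven, if_true, if_neg hn, mul_one]
      rw [weilWindowSesq_smul_left,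
        weilWindowSesq_add_left ha.le (isWindowFunction_chi ha _) (isWindowFunction_chi ha _)
          (isWindowFunction_chi ha _), weilWindowSesq_chi ha, weilWindowSesq_chi ha, hsC]
      push_cast
      rw [hrefl0']
      ring
    · simp only [chiEven, if_neg hn, if_neg hm]
      rw [weilWindowSesq_smul_left, weilWindowSesq_smul_right, Complex.conj_ofReal,
        weilWindowSesq_add_left ha.le (isWindowFunction_chi ha _) (isWindowFunction_chi ha _)
          ((isWindowFunction_chi ha _).add (isWindowFunction_chi ha _)),
        weilWindowSesq_add_right ha.le (isWindowFunction_chi ha _) (isWindowFunction_chi ha _)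
          (isWindowFunction_chi ha _),
        weilWindowSesq_add_right ha.le (isWindowFunction_chi ha _) (isWindowFunction_chi ha _)
          (isWindowFunction_chi ha _),
        weilWindowSesq_chi ha, weilWindowSesq_chi ha, weilWindowSesq_chi ha, weilWindowSesq_chi ha,
        gramCoeff_neg_neg, show gramCoeff a (-(n : ℤ)) m = gramCoeff a n (-(m : ℤ)) by
          rw [← gramCoeff_neg_neg a (-(n : ℤ)) m, neg_neg], hsC]
      push_cast
      ring

/-! ## Even windows on the even basis -/

/-- **`proj_P` of an even window on the even basis**: `proj_P φ = Σ_{i∈[0,P]} ζ_i • w⁺_i`,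
`ζ_0 = ĉ_0/√(2a)`, `ζ_i = √2 ĉ_i/√(2a)`. -/
theorem proj_eq_sum_chiEven {φ : ℝ → ℂ} (hφ : ∀ x, φ (-x) = φ x) (a : ℝ) (P : ℕ) :
    proj a P φ = ∑ i ∈ Finset.range (P + 1),
      (if i = 0 then (((1 / Real.sqrt (2 * a) : ℝ) : ℂ)) * Yoshida1992.fourierCoeff a 0 φ
        else ((Real.sqrt 2 : ℝ) : ℂ) * ((((1 / Real.sqrt (2 * a) : ℝ) : ℂ)) * Yoshida1992.fourierCoeff a i φ)) •
        chiEven a i := by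
  unfold proj
  rw [sum_modes_smul_chi_of_even P _ (fun n ↦ by rw [fourierCoeff_neg_eq_of_even hφ])]

/-- **The band of an even window on the even basis**: for `B' ≤ P`,
`proj_P φ − proj_{B'} φ = Σ_{i∈[B'+1,P+1)} ζ_i • w⁺_i`. -/
theorem band_eq_sum_chiEven {φ : ℝ → ℂ} (hφ : ∀ x, φ (-x) = φ x) (a : ℝ) {B' P : ℕ} (hBP : B' ≤ P) :
    proj a P φ - proj a B' φ = ∑ i ∈ Finset.Ico (B' + 1) (P + 1),
      (if i = 0 then (((1 / Real.sqrt (2 * a) : ℝ) : ℂ)) * Yoshida1992.fourierCoeff a 0 φ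
        else ((Real.sqrt 2 : ℝ) : ℂ) * ((((1 / Real.sqrt (2 * a) : ℝ) : ℂ)) * Yoshida1992.fourierCoeff a i φ)) •
        chiEven a i := by
  rw [proj_eq_sum_chiEven hφ, proj_eq_sum_chiEven hφ, Finset.range_eq_Ico, Finset.range_eq_Ico]
  rw [← Finset.sum_Ico_consecutive _ (Nat.zero_le (B' + 1)) (by omega : B' + 1 ≤ P + 1)]
  simp only [add_sub_cancel_left]

/-! ## The row identity and the band × band identity -/

section Rows

variable {φ ψ : ℝ → ℂ}

/-- The coefficient `ζ_i` of an even real window is the real number `d_i Re ĉ_i/√(2a)`. -/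
theorem zeta_eq_ofReal (hφ : ∀ x, φ (-x) = φ x) (hφr : ∀ x, conj (φ x) = φ x) (a : ℝ) (i : ℕ) :
    (if i = 0 then (((1 / Real.sqrt (2 * a) : ℝ) : ℂ)) * Yoshida1992.fourierCoeff a 0 φ
      else ((Real.sqrt 2 : ℝ) : ℂ) * ((((1 / Real.sqrt (2 * a) : ℝ) : ℂ)) * Yoshida1992.fourierCoeff a i φ))
    = ((((if i = 0 then 1 else Real.sqrt 2) * (Yoshida1992.fourierCoeff a i φ).re / Real.sqrt (2 * a)) : ℝ) : ℂ) := by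
  by_cases hi : i = 0
  · subst hi
    simp only [if_true, Nat.cast_zero, one_mul]
    rw [fourierCoeff_eq_ofReal_re hφ hφr]
    simp only [Complex.ofReal_re]
    push_cast
    ring
  · simp only [if_neg hi]
    rw [fourierCoeff_eq_ofReal_re hφ hφr]
    simp only [Complex.ofReal_re]
    push_cast
    ring

/-- **The row identity** (`a > 0`, `φ` an even real window function, `B' ≤ P`): with the REAL table
`V(n) = d_n² Re ĉ_n(φ)/√(2a)` (`d_0² = 1`, `d_n² = 2`),
`Σ_{n∈[B'+1,P+1)} M⁺(n,m)·V(n) = Re W_a(proj_P φ − proj_{B'} φ, w⁺_m)/d_m`. -/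
theorem sum_Ico_evenKernel_mul_eq (ha : 0 < a) (hφ : ∀ x, φ (-x) = φ x) (hφr : ∀ x, conj (φ x) = φ x)
    {B' P : ℕ} (hBP : B' ≤ P) (m : ℕ) :
    ∑ n ∈ Finset.Ico (B' + 1) (P + 1),
      (if n = 0 then gramCoeff a 0 m else if m = 0 then gramCoeff a n 0
        else (gramCoeff a n m + gramCoeff a n (-(m : ℤ))) / 2) *
        ((if n = 0 then 1 else 2) * (Yoshida1992.fourierCoeff a n φ).re / Real.sqrt (2 * a))
      = (weilWindowSesq a (proj a P φ - proj a B' φ) (chiEven a m)).re / (if m = 0 then 1 else Real.sqrt 2) := by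
  have hdm : (0 : ℝ) < (if m = 0 then 1 else Real.sqrt 2) := by
    split_ifs
    · norm_num
    · exact Real.sqrt_pos.2 (by norm_num)
  rw [eq_div_iff hdm.ne', band_eq_sum_chiEven hφ a hBP,
    weilWindowSesq_sum_left ha.le _ (fun i _ ↦ isWindowFunction_chiEven ha i) (isWindowFunction_chiEven ha m) _ a]
  simp_rw [zeta_eq_ofReal hφ hφr, weilWindowSesq_chiEven_chiEven ha, ← Complex.ofReal_mul]
  rw [← Complex.ofReal_sum, Complex.ofReal_re, Finset.sum_mul]
  refine Finset.sum_congr rfl fun n hn ↦ ?_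
  have hn0 : n ≠ 0 := by have := (Finset.mem_Ico.1 hn).1; omega
  simp only [if_neg hn0]
  have hs2 : Real.sqrt 2 * Real.sqrt 2 = 2 := Real.mul_self_sqrt (by norm_num)
  split_ifs with hm
  · linear_combination (-(gramCoeff a n 0 * (Yoshida1992.fourierCoeff a n φ).re / Real.sqrt (2 * a))) * hs2
  · linear_combination (-((gramCoeff a n m + gramCoeff a n (-(m : ℤ))) / 2 *
      (Yoshida1992.fourierCoeff a n φ).re * Real.sqrt 2 / Real.sqrt (2 * a))) * hs2

end Rows

/-! ## The band × band identity -/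

/-- **The band × band identity** (`a > 0`, `φ, ψ` even real window functions, `B' ≤ P`):
`Σ_{n,n'∈[B'+1,P+1)} V_φ(n)·M⁺(n,n')·V_ψ(n') = Re W_a(proj_P φ − proj_{B'} φ, proj_P ψ − proj_{B'} ψ)`. -/
theorem sum_Ico_Ico_evenKernel_eq (ha : 0 < a) {φ ψ : ℝ → ℂ} (hφ : ∀ x, φ (-x) = φ x)
    (hφr : ∀ x, conj (φ x) = φ x) (hψ : ∀ x, ψ (-x) = ψ x) (hψr : ∀ x, conj (ψ x) = ψ x)
    (hφw : IsWindowFunction a φ) (hψw : IsWindowFunction a ψ) {B' P : ℕ} (hBP : B' ≤ P) :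
    ∑ n ∈ Finset.Ico (B' + 1) (P + 1), ∑ n' ∈ Finset.Ico (B' + 1) (P + 1),
      ((if n = 0 then 1 else 2) * (Yoshida1992.fourierCoeff a n φ).re / Real.sqrt (2 * a)) *
        (if n = 0 then gramCoeff a 0 n' else if n' = 0 then gramCoeff a n 0
          else (gramCoeff a n n' + gramCoeff a n (-(n' : ℤ))) / 2) *
        ((if n' = 0 then 1 else 2) * (Yoshida1992.fourierCoeff a n' ψ).re / Real.sqrt (2 * a))
      = (weilWindowSesq a (proj a P φ - proj a B' φ) (proj a P ψ - proj a B' ψ)).re := by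
  have _ := hφw
  have _ := hψw
  rw [band_eq_sum_chiEven hφ a hBP, band_eq_sum_chiEven hψ a hBP,
    weilWindowSesq_sum_left ha.le _ (fun i _ ↦ isWindowFunction_chiEven ha i)
      (IsWindowFunction.sum _ _ fun i _ ↦ isWindowFunction_chiEven ha i) _ a]
  simp_rw [weilWindowSesq_sum_right ha.le _ (fun i _ ↦ isWindowFunction_chiEven ha i) (isWindowFunction_chiEven ha _)
    _ a, zeta_eq_ofReal hφ hφr, zeta_eq_ofReal hψ hψr, Complex.conj_ofReal, weilWindowSesq_chiEven_chiEven ha,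
    ← Complex.ofReal_mul, Finset.mul_sum, ← Complex.ofReal_mul, ← Complex.ofReal_sum, Complex.ofReal_re]
  refine Finset.sum_congr rfl fun n hn ↦ Finset.sum_congr rfl fun n' hn' ↦ ?_
  have hn0 : n ≠ 0 := by have := (Finset.mem_Ico.1 hn).1; omega
  have hn0' : n' ≠ 0 := by have := (Finset.mem_Ico.1 hn').1; omega
  simp only [if_neg hn0, if_neg hn0']
  have hs4 : Real.sqrt 2 * Real.sqrt 2 * (Real.sqrt 2 * Real.sqrt 2) = 4 := by
    rw [Real.mul_self_sqrt (by norm_num : (0:ℝ) ≤ 2)]; norm_num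
  linear_combination (-((gramCoeff a n n' + gramCoeff a n (-(n' : ℤ))) / 2 * (Yoshida1992.fourierCoeff a n φ).re *
    (Yoshida1992.fourierCoeff a n' ψ).re / (Real.sqrt (2 * a) * Real.sqrt (2 * a)))) * hs4

/-! ## Limits: the hypotheses `hc`, `hG` of the C∞ soundness theorem for even profiles -/

section Limits

/-- The even basis vector as a trigonometric window on `{m, −m}`. -/
theorem chiEven_eq_sum_smul_chi (a : ℝ) (m : ℕ) :
    chiEven a m = ∑ k ∈ ({(m : ℤ), -(m : ℤ)} : Finset ℤ),
      (if m = 0 then (1 : ℂ) else (((1 / Real.sqrt 2 : ℝ)) : ℂ)) • chi a k := by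
  unfold chiEven
  by_cases hm : m = 0
  · subst hm
    simp
  · have hne : (m : ℤ) ≠ -(m : ℤ) := by omega
    rw [if_neg hm, Finset.sum_pair hne, if_neg hm, smul_add]

variable {f g : ℝ → ℂ}

/-- **`hc` for an even profile**: for `f ∈ C³` even, real, with `f′(−a) = f′(a)` (`a > 0`), the kernel rows of the
table `V(n) = d_n² Re ĉ_n(1f)/√(2a)` against the even kernel converge:
`Σ_{n∈[B'+1,P)} M⁺(n,m)V(n) → Re W_a(1f − proj_{B'}(1f), w⁺_m)/d_m`. -/
theorem tendsto_sum_Ico_evenKernel_mul (ha : 0 < a) (hf : ContDiff ℝ 3 f) (hfe : ∀ x, f (-x) = f x)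
    (hfr : ∀ x, conj (f x) = f x) (hf1 : deriv f (-a) = deriv f a) (B' m : ℕ) :
    Tendsto (fun P ↦ ∑ n ∈ Finset.Ico (B' + 1) P,
      (if n = 0 then gramCoeff a 0 m else if m = 0 then gramCoeff a n 0
        else (gramCoeff a n m + gramCoeff a n (-(m : ℤ))) / 2) *
        ((if n = 0 then 1 else 2) * (Yoshida1992.fourierCoeff a n ((Icc (-a) a).indicator f)).re / Real.sqrt (2 * a)))
      atTop
      (𝓝 ((weilWindowSesq a ((Icc (-a) a).indicator f - proj a B' ((Icc (-a) a).indicator f)) (chiEven a m)).re /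
        (if m = 0 then 1 else Real.sqrt 2))) := by
  set φ := (Icc (-a) a).indicator f with hφdef
  have hφ : ∀ x, φ (-x) = φ x := indicator_even hfe a
  have hφr : ∀ x, conj (φ x) = φ x := indicator_real hfr a
  have hfe₀ : f (-a) = f a := hfe a
  obtain ⟨hφw, -, -, -, -⟩ := summableClass_indicator_of_contDiff ha hf hfe₀ hf1
  -- the band limit in the left slot, via conjugate symmetry
  have hlim : Tendsto (fun P ↦ (weilWindowSesq a (proj a P φ - proj a B' φ) (chiEven a m)).re) atTop
      (𝓝 ((weilWindowSesq a (φ - proj a B' φ) (chiEven a m)).re)) := by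
    have h := tendsto_weilWindowSesq_trig_band_indicator ha ({(m : ℤ), -(m : ℤ)} : Finset ℤ)
      (fun _ ↦ if m = 0 then (1 : ℂ) else (((1 / Real.sqrt 2 : ℝ)) : ℂ)) hf hfe₀ hf1 B'
    rw [← chiEven_eq_sum_smul_chi] at h
    have h' := (Complex.continuous_re.tendsto _).comp h
    refine (h'.congr fun P ↦ ?_).trans ?_
    · simp only [Function.comp]
      rw [weilWindowSesq_conj_symm a (chiEven a m), Complex.conj_re]
    · rw [weilWindowSesq_conj_symm a (chiEven a m), Complex.conj_re]
  -- shift `P ↦ P + 1` and use the row identity eventually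
  rw [← tendsto_add_atTop_iff_nat 1]
  refine ((hlim.div_const (if m = 0 then 1 else Real.sqrt 2)).congr' ?_)
  filter_upwards [eventually_ge_atTop B'] with P hP
  rw [sum_Ico_evenKernel_mul_eq ha hφ hφr hP m]

/-- **`hG` for two even profiles**: the band × band entries converge:
`Σ_{n,n'∈[B'+1,P)} V_f(n)M⁺(n,n')V_g(n') → Re W_a(1f − proj_{B'}1f, 1g − proj_{B'}1g)`. -/
theorem tendsto_sum_Ico_Ico_evenKernel (ha : 0 < a) (hf : ContDiff ℝ 3 f) (hfe : ∀ x, f (-x) = f x)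
    (hfr : ∀ x, conj (f x) = f x) (hf1 : deriv f (-a) = deriv f a) (hg : ContDiff ℝ 3 g)
    (hge : ∀ x, g (-x) = g x) (hgr : ∀ x, conj (g x) = g x) (hg1 : deriv g (-a) = deriv g a) (B' : ℕ) :
    Tendsto (fun P ↦ ∑ n ∈ Finset.Ico (B' + 1) P, ∑ n' ∈ Finset.Ico (B' + 1) P,
      ((if n = 0 then 1 else 2) * (Yoshida1992.fourierCoeff a n ((Icc (-a) a).indicator f)).re / Real.sqrt (2 * a)) *
        (if n = 0 then gramCoeff a 0 n' else if n' = 0 then gramCoeff a n 0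
          else (gramCoeff a n n' + gramCoeff a n (-(n' : ℤ))) / 2) *
        ((if n' = 0 then 1 else 2) * (Yoshida1992.fourierCoeff a n' ((Icc (-a) a).indicator g)).re /
          Real.sqrt (2 * a)))
      atTop
      (𝓝 ((weilWindowSesq a ((Icc (-a) a).indicator f - proj a B' ((Icc (-a) a).indicator f))
        ((Icc (-a) a).indicator g - proj a B' ((Icc (-a) a).indicator g))).re)) := by
  set φ := (Icc (-a) a).indicator f with hφdef
  set ψ := (Icc (-a) a).indicator g with hψdef
  have hφ : ∀ x, φ (-x) = φ x := indicator_even hfe a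
  have hφr : ∀ x, conj (φ x) = φ x := indicator_real hfr a
  have hψ : ∀ x, ψ (-x) = ψ x := indicator_even hge a
  have hψr : ∀ x, conj (ψ x) = ψ x := indicator_real hgr a
  obtain ⟨hφw, -, -, -, -⟩ := summableClass_indicator_of_contDiff ha hf (hfe a) hf1
  obtain ⟨hψw, -, -, -, -⟩ := summableClass_indicator_of_contDiff ha hg (hge a) hg1
  have h := tendsto_weilWindowSesq_band_band_indicator ha hf (hfe a) hf1 hg (hge a) hg1 B'
  have h' := (Complex.continuous_re.tendsto _).comp h
  rw [← tendsto_add_atTop_iff_nat 1]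
  refine h'.congr' ?_
  filter_upwards [eventually_ge_atTop B'] with P hP
  simp only [Function.comp]
  rw [sum_Ico_Ico_evenKernel_eq ha hφ hφr hψ hψr hφw hψw hP]

end Limits


end Summit.RiemannHypothesis.RiemannHypothesis.Theorems.WeilFormatC

end
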